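import Mathlib
import HarnessLib

/-!
# Modal unfoldings, modal products and the multilinear product of an order-3 tensor
(Golub–Van Loan §12.4.5, §12.4.8, §12.4.10–12.4.11, Theorem 12.4.1; Kolda–Bader §2.4–2.5)

Topic `LinearAlgebra/TensorNetworks`.  Golub–Van Loan, *Matrix Computations* (4th ed., 2013), §12.4
(held copy `book:golub2012-matrix-computations`, PDF pp. 669–676): the mode-`k` unfolding
`𝓐₍ₖ₎` is the `n_k × (N/n_k)` matrix whose columns are the mode-`k` fibres, ordered by the `vec`
(first-index-fastest) rule (12.4.6); the modal unfoldings of a rank-1 tensor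
`z⁽¹⁾ ∘ z⁽²⁾ ∘ z⁽³⁾` are the rank-one matrices `A₍₁₎ = z⁽¹⁾ (z⁽³⁾ ⊗ z⁽²⁾)ᵀ`,
`A₍₂₎ = z⁽²⁾ (z⁽³⁾ ⊗ z⁽¹⁾)ᵀ`, `A₍₃₎ = z⁽³⁾ (z⁽²⁾ ⊗ z⁽¹⁾)ᵀ` (12.4.9); the mode-`k` product
`𝓐 = 𝓢 ×ₖ M` is defined by `𝓐₍ₖ₎ = M · 𝓢₍ₖ₎` (12.4.14), equivalently entrywise
`𝓐(…, i, …) = Σ_j M(i, j) 𝓢(…, j, …)`; modal products in different modes commute (12.4.16) and in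
the same mode compose, `(𝓢 ×ₖ F) ×ₖ G = 𝓢 ×ₖ (G F)` (12.4.17 — GVL print `𝓢 ×ₖ (FG)` in the
convention `A₍ₖ₎ = M 𝓢₍ₖ₎` reads `G F`; Kolda–Bader §2.5 states it as `𝓧 ×ₙ A ×ₙ B = 𝓧 ×ₙ (BA)`);
and **Theorem 12.4.1**: if `𝓐 = 𝓢 ×₁ M₁ ×₂ M₂ ⋯ ×_d M_d` then
`𝓐₍ₖ₎ = M_k · 𝓢₍ₖ₎ · (M_d ⊗ ⋯ ⊗ M_{k+1} ⊗ M_{k−1} ⊗ ⋯ ⊗ M₁)ᵀ`, and if all `M_k` are nonsingular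
then `𝓢 = 𝓐 ×₁ M₁⁻¹ ⋯ ×_d M_d⁻¹`.  Kolda–Bader, *Tensor Decompositions and Applications* (SIAM
Rev. 2009), §2.4–§2.5 (held preprint `paper:doi-10-1137-07070111x`, pp. 6–8): matricisation
`X₍ₙ₎`, the `n`-mode product `(𝓧 ×ₙ U)₍ₙ₎ = U X₍ₙ₎`, the properties
`𝓧 ×_m A ×ₙ B = 𝓧 ×ₙ B ×_m A` (`m ≠ n`), `𝓧 ×ₙ A ×ₙ B = 𝓧 ×ₙ (BA)`, and
`𝓨 = 𝓧 ×₁ A⁽¹⁾ ⋯ ×_N A⁽ᴺ⁾ ⇔ Y₍ₙ₎ = A⁽ⁿ⁾ X₍ₙ₎ (A⁽ᴺ⁾ ⊗ ⋯ ⊗ A⁽ⁿ⁺¹⁾ ⊗ A⁽ⁿ⁻¹⁾ ⊗ ⋯ ⊗ A⁽¹⁾)ᵀ`;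
§4 (p. 21): the order-3 matricised Tucker forms `X₍₁₎ = A G₍₁₎ (C ⊗ B)ᵀ`,
`X₍₂₎ = B G₍₂₎ (C ⊗ A)ᵀ`, `X₍₃₎ = C G₍₃₎ (B ⊗ A)ᵀ`, and "CP can be viewed as a special case of
Tucker where the core tensor is superdiagonal"; §2.3 (p. 5) diagonal tensors.
(Both held texts were read at these places.)

This file is the ORDER-3 case `𝓢 : n₁ → n₂ → n₃ → R` in Mathlib's pair indexing of Kronecker
products (`(A ⊗ₖ B) (i, j) (k, l) = A i k * B j l`; the `vec` rule "earlier index faster" becomes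
"earlier index in the SECOND pair component"):
* `unfold₁ 𝓢 : Matrix n₁ (n₃ × n₂) R`, `unfold₂ 𝓢 : Matrix n₂ (n₃ × n₁) R`,
  `unfold₃ 𝓢 : Matrix n₃ (n₂ × n₁) R` (12.4.6); `modeProd₁/₂/₃` (12.4.14, entrywise form);
  `outer₃ u v w` (rank-1 tensor, §12.4.8);
* (12.4.14) `unfold₁_modeProd₁ : unfold₁ (𝓢 ×₁ M) = M * unfold₁ 𝓢` (and modes 2, 3), and the
  cross-mode forms `unfold₁ (𝓢 ×₂ M) = unfold₁ 𝓢 * (1 ⊗ₖ M)ᵀ`, `unfold₁ (𝓢 ×₃ M) = unfold₁ 𝓢 *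
  (M ⊗ₖ 1)ᵀ` (six lemmas, the "vec ordering of the fibres" in GVL's proof of Theorem 12.4.1);
* (12.4.16) `modeProd₁_modeProd₂_comm` etc., (12.4.17) `modeProd₁_modeProd₁` etc.,
  `modeProd₁_one` etc.;
* **Theorem 12.4.1** (`d = 3`): `unfold₁_multilinear₃ : unfold₁ (𝓢 ×₁ M₁ ×₂ M₂ ×₃ M₃) =
  M₁ * unfold₁ 𝓢 * (M₃ ⊗ₖ M₂)ᵀ`, `unfold₂_multilinear₃`, `unfold₃_multilinear₃`, and
  `multilinear₃_inv` (nonsingular `M_k`: `𝓢` is recovered by the inverse multilinear product);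
  the entrywise form (12.4.18) `multilinear₃_apply`;
* (12.4.9) `unfold₁_outer₃ : unfold₁ (u ∘ v ∘ w) = u · (w ⊗ v)ᵀ` (as `vecMulVec`), modes 2, 3;
* CP tensors `cp₃ λ A B C = Σ_s λ_s a_s ∘ b_s ∘ c_s` (Kolda–Bader §3, pp. 8–9; GVL §12.5.4,
  PDF p. 683): the matricised forms (3.2) `unfold₁_cp₃ : X₍₁₎ = A · diag(λ) · (C ⊙ B)ᵀ` (modes
  2, 3), with the Khatri–Rao factor written entrywise (it is `khatriRao C B` of the sibling file
  `KhatriRaoProduct`), and `multilinear₃_superdiag₃ : diag₃(λ) ×₁ A ×₂ B ×₃ C = cp₃ λ A B C`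
  (CP = Tucker with superdiagonal core, Kolda–Bader §4).
-/

open Matrix
open scoped Kronecker

namespace Literature.LinearAlgebra.TensorNetworks

universe u

variable {R : Type u} {n₁ n₂ n₃ m₁ m₂ m₃ l₁ l₂ l₃ : Type*}

/-! ## Modal unfoldings (12.4.6) -/

section Unfold

/-- Mode-1 unfolding `𝓢₍₁₎ : n₁ × (n₃ n₂)`, columns = mode-1 fibres in `vec` order (`i₂` faster than
`i₃`, i.e. column index `(i₃, i₂)` in Kronecker pair indexing).
[cite: GolubVanLoan2013, §12.4.5 (12.4.6)] [cite: KoldaBader2009, §2.4] -/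
def unfold₁ (S : n₁ → n₂ → n₃ → R) : Matrix n₁ (n₃ × n₂) R :=
  Matrix.of fun i kj => S i kj.2 kj.1

/-- Mode-2 unfolding `𝓢₍₂₎ : n₂ × (n₃ n₁)`, column index `(i₃, i₁)`.
[cite: GolubVanLoan2013, §12.4.5 (12.4.6)] [cite: KoldaBader2009, §2.4] -/
def unfold₂ (S : n₁ → n₂ → n₃ → R) : Matrix n₂ (n₃ × n₁) R :=
  Matrix.of fun j ki => S ki.2 j ki.1

/-- Mode-3 unfolding `𝓢₍₃₎ : n₃ × (n₂ n₁)`, column index `(i₂, i₁)`.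
[cite: GolubVanLoan2013, §12.4.5 (12.4.6)] [cite: KoldaBader2009, §2.4] -/
def unfold₃ (S : n₁ → n₂ → n₃ → R) : Matrix n₃ (n₂ × n₁) R :=
  Matrix.of fun k ji => S ji.2 ji.1 k

/-- [cite: GolubVanLoan2013, §12.4.5 (12.4.6)] -/
@[simp]
theorem unfold₁_apply (S : n₁ → n₂ → n₃ → R) (i : n₁) (k : n₃) (j : n₂) :
    unfold₁ S i (k, j) = S i j k := rfl

/-- [cite: GolubVanLoan2013, §12.4.5 (12.4.6)] -/
@[simp]
theorem unfold₂_apply (S : n₁ → n₂ → n₃ → R) (j : n₂) (k : n₃) (i : n₁) :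
    unfold₂ S j (k, i) = S i j k := rfl

/-- [cite: GolubVanLoan2013, §12.4.5 (12.4.6)] -/
@[simp]
theorem unfold₃_apply (S : n₁ → n₂ → n₃ → R) (k : n₃) (j : n₂) (i : n₁) :
    unfold₃ S k (j, i) = S i j k := rfl

/-- The unfoldings determine the tensor (mode 1).  [cite: GolubVanLoan2013, §12.4.5] -/
theorem unfold₁_injective : Function.Injective (unfold₁ : (n₁ → n₂ → n₃ → R) → _) := by
  intro S T h
  funext i j k
  simpa using congr_fun (congr_fun h i) (k, j)

end Unfold

/-! ## Rank-1 tensors and their unfoldings (12.4.9) -/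

section RankOne

variable [Mul R]

/-- The rank-1 (outer product) tensor `u ∘ v ∘ w`, `(i, j, k) ↦ u i * v j * w k`.
[cite: GolubVanLoan2013, §12.4.7-§12.4.8] [cite: KoldaBader2009, §2.1] -/
def outer₃ (u : n₁ → R) (v : n₂ → R) (w : n₃ → R) : n₁ → n₂ → n₃ → R :=
  fun i j k => u i * v j * w k

/-- [cite: GolubVanLoan2013, §12.4.8] -/
@[simp]
theorem outer₃_apply (u : n₁ → R) (v : n₂ → R) (w : n₃ → R) (i : n₁) (j : n₂) (k : n₃) :
    outer₃ u v w i j k = u i * v j * w k := rfl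

end RankOne

section RankOneUnfold

variable [CommSemigroup R]

/-- GVL (12.4.9), mode 1: `(u ∘ v ∘ w)₍₁₎ = u · (w ⊗ v)ᵀ` — a rank-one matrix (`vecMulVec`).
[cite: GolubVanLoan2013, §12.4.8 (12.4.9)] -/
theorem unfold₁_outer₃ (u : n₁ → R) (v : n₂ → R) (w : n₃ → R) :
    unfold₁ (outer₃ u v w) = vecMulVec u fun kj : n₃ × n₂ => w kj.1 * v kj.2 := by
  ext i ⟨k, j⟩
  simp only [unfold₁_apply, outer₃_apply, vecMulVec_apply]
  rw [mul_assoc, mul_comm (v j)]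

/-- GVL (12.4.9), mode 2: `(u ∘ v ∘ w)₍₂₎ = v · (w ⊗ u)ᵀ`.
[cite: GolubVanLoan2013, §12.4.8 (12.4.9)] -/
theorem unfold₂_outer₃ (u : n₁ → R) (v : n₂ → R) (w : n₃ → R) :
    unfold₂ (outer₃ u v w) = vecMulVec v fun ki : n₃ × n₁ => w ki.1 * u ki.2 := by
  ext j ⟨k, i⟩
  simp only [unfold₂_apply, outer₃_apply, vecMulVec_apply]
  rw [mul_comm (u i), mul_assoc, mul_comm (u i)]

/-- GVL (12.4.9), mode 3: `(u ∘ v ∘ w)₍₃₎ = w · (v ⊗ u)ᵀ`.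
[cite: GolubVanLoan2013, §12.4.8 (12.4.9)] -/
theorem unfold₃_outer₃ (u : n₁ → R) (v : n₂ → R) (w : n₃ → R) :
    unfold₃ (outer₃ u v w) = vecMulVec w fun ji : n₂ × n₁ => v ji.1 * u ji.2 := by
  ext k ⟨j, i⟩
  simp only [unfold₃_apply, outer₃_apply, vecMulVec_apply]
  rw [mul_comm (u i), mul_comm _ (w k)]

end RankOneUnfold

/-! ## Modal products (12.4.14) -/

section ModeProd

variable [NonUnitalNonAssocSemiring R]

/-- The mode-1 product `𝓢 ×₁ M`, `(i, j, k) ↦ Σ_{i'} M i i' · 𝓢 i' j k`.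
[cite: GolubVanLoan2013, §12.4.10 (12.4.14)] [cite: KoldaBader2009, §2.5] -/
def modeProd₁ [Fintype n₁] (S : n₁ → n₂ → n₃ → R) (M : Matrix m₁ n₁ R) : m₁ → n₂ → n₃ → R :=
  fun i j k => ∑ i', M i i' * S i' j k

/-- The mode-2 product `𝓢 ×₂ M`.
[cite: GolubVanLoan2013, §12.4.10 (12.4.14)] [cite: KoldaBader2009, §2.5] -/
def modeProd₂ [Fintype n₂] (S : n₁ → n₂ → n₃ → R) (M : Matrix m₂ n₂ R) : n₁ → m₂ → n₃ → R :=
  fun i j k => ∑ j', M j j' * S i j' k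

/-- The mode-3 product `𝓢 ×₃ M`.
[cite: GolubVanLoan2013, §12.4.10 (12.4.14)] [cite: KoldaBader2009, §2.5] -/
def modeProd₃ [Fintype n₃] (S : n₁ → n₂ → n₃ → R) (M : Matrix m₃ n₃ R) : n₁ → n₂ → m₃ → R :=
  fun i j k => ∑ k', M k k' * S i j k'

/-- [cite: GolubVanLoan2013, §12.4.10] -/
@[simp]
theorem modeProd₁_apply [Fintype n₁] (S : n₁ → n₂ → n₃ → R) (M : Matrix m₁ n₁ R) (i j k) :
    modeProd₁ S M i j k = ∑ i', M i i' * S i' j k := rfl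

/-- [cite: GolubVanLoan2013, §12.4.10] -/
@[simp]
theorem modeProd₂_apply [Fintype n₂] (S : n₁ → n₂ → n₃ → R) (M : Matrix m₂ n₂ R) (i j k) :
    modeProd₂ S M i j k = ∑ j', M j j' * S i j' k := rfl

/-- [cite: GolubVanLoan2013, §12.4.10] -/
@[simp]
theorem modeProd₃_apply [Fintype n₃] (S : n₁ → n₂ → n₃ → R) (M : Matrix m₃ n₃ R) (i j k) :
    modeProd₃ S M i j k = ∑ k', M k k' * S i j k' := rfl

/-- GVL (12.4.14), mode 1: `(𝓢 ×₁ M)₍₁₎ = M · 𝓢₍₁₎`.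
[cite: GolubVanLoan2013, §12.4.10 (12.4.14)] [cite: KoldaBader2009, §2.5] -/
theorem unfold₁_modeProd₁ [Fintype n₁] (S : n₁ → n₂ → n₃ → R) (M : Matrix m₁ n₁ R) :
    unfold₁ (modeProd₁ S M) = M * unfold₁ S := by
  ext i ⟨k, j⟩
  simp [mul_apply]

/-- GVL (12.4.14), mode 2: `(𝓢 ×₂ M)₍₂₎ = M · 𝓢₍₂₎`.
[cite: GolubVanLoan2013, §12.4.10 (12.4.14)] [cite: KoldaBader2009, §2.5] -/
theorem unfold₂_modeProd₂ [Fintype n₂] (S : n₁ → n₂ → n₃ → R) (M : Matrix m₂ n₂ R) :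
    unfold₂ (modeProd₂ S M) = M * unfold₂ S := by
  ext j ⟨k, i⟩
  simp [mul_apply]

/-- GVL (12.4.14), mode 3: `(𝓢 ×₃ M)₍₃₎ = M · 𝓢₍₃₎`.
[cite: GolubVanLoan2013, §12.4.10 (12.4.14)] [cite: KoldaBader2009, §2.5] -/
theorem unfold₃_modeProd₃ [Fintype n₃] (S : n₁ → n₂ → n₃ → R) (M : Matrix m₃ n₃ R) :
    unfold₃ (modeProd₃ S M) = M * unfold₃ S := by
  ext k ⟨j, i⟩
  simp [mul_apply]

end ModeProd

/-! ## Cross-mode unfoldings: the Kronecker factors of Theorem 12.4.1 -/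

section Cross

variable [CommSemiring R]

/-- `(𝓢 ×₂ M)₍₁₎ = 𝓢₍₁₎ · (I ⊗ M)ᵀ` (the mode-2 product seen from mode 1).
[cite: GolubVanLoan2013, Thm. 12.4.1 (proof, via (12.4.15))] -/
theorem unfold₁_modeProd₂ [Fintype n₂] [Fintype n₃] [DecidableEq n₃] (S : n₁ → n₂ → n₃ → R)
    (M : Matrix m₂ n₂ R) :
    unfold₁ (modeProd₂ S M) = unfold₁ S * ((1 : Matrix n₃ n₃ R) ⊗ₖ M)ᵀ := by
  ext i ⟨k, j⟩
  simp [mul_apply, Fintype.sum_prod_type, one_apply, ite_mul, mul_comm]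

/-- `(𝓢 ×₃ M)₍₁₎ = 𝓢₍₁₎ · (M ⊗ I)ᵀ`.
[cite: GolubVanLoan2013, Thm. 12.4.1 (proof, via (12.4.15))] -/
theorem unfold₁_modeProd₃ [Fintype n₂] [Fintype n₃] [DecidableEq n₂] (S : n₁ → n₂ → n₃ → R)
    (M : Matrix m₃ n₃ R) :
    unfold₁ (modeProd₃ S M) = unfold₁ S * (M ⊗ₖ (1 : Matrix n₂ n₂ R))ᵀ := by
  ext i ⟨k, j⟩
  simp [mul_apply, Fintype.sum_prod_type, one_apply, mul_ite, mul_comm]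

/-- `(𝓢 ×₁ M)₍₂₎ = 𝓢₍₂₎ · (I ⊗ M)ᵀ`.
[cite: GolubVanLoan2013, Thm. 12.4.1 (proof, via (12.4.15))] -/
theorem unfold₂_modeProd₁ [Fintype n₁] [Fintype n₃] [DecidableEq n₃] (S : n₁ → n₂ → n₃ → R)
    (M : Matrix m₁ n₁ R) :
    unfold₂ (modeProd₁ S M) = unfold₂ S * ((1 : Matrix n₃ n₃ R) ⊗ₖ M)ᵀ := by
  ext j ⟨k, i⟩
  simp [mul_apply, Fintype.sum_prod_type, one_apply, ite_mul, mul_comm]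

/-- `(𝓢 ×₃ M)₍₂₎ = 𝓢₍₂₎ · (M ⊗ I)ᵀ`.
[cite: GolubVanLoan2013, Thm. 12.4.1 (proof, via (12.4.15))] -/
theorem unfold₂_modeProd₃ [Fintype n₁] [Fintype n₃] [DecidableEq n₁] (S : n₁ → n₂ → n₃ → R)
    (M : Matrix m₃ n₃ R) :
    unfold₂ (modeProd₃ S M) = unfold₂ S * (M ⊗ₖ (1 : Matrix n₁ n₁ R))ᵀ := by
  ext j ⟨k, i⟩
  simp [mul_apply, Fintype.sum_prod_type, one_apply, mul_ite, mul_comm]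

/-- `(𝓢 ×₁ M)₍₃₎ = 𝓢₍₃₎ · (I ⊗ M)ᵀ`.
[cite: GolubVanLoan2013, Thm. 12.4.1 (proof, via (12.4.15))] -/
theorem unfold₃_modeProd₁ [Fintype n₁] [Fintype n₂] [DecidableEq n₂] (S : n₁ → n₂ → n₃ → R)
    (M : Matrix m₁ n₁ R) :
    unfold₃ (modeProd₁ S M) = unfold₃ S * ((1 : Matrix n₂ n₂ R) ⊗ₖ M)ᵀ := by
  ext k ⟨j, i⟩
  simp [mul_apply, Fintype.sum_prod_type, one_apply, ite_mul, mul_comm]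

/-- `(𝓢 ×₂ M)₍₃₎ = 𝓢₍₃₎ · (M ⊗ I)ᵀ`.
[cite: GolubVanLoan2013, Thm. 12.4.1 (proof, via (12.4.15))] -/
theorem unfold₃_modeProd₂ [Fintype n₁] [Fintype n₂] [DecidableEq n₁] (S : n₁ → n₂ → n₃ → R)
    (M : Matrix m₂ n₂ R) :
    unfold₃ (modeProd₂ S M) = unfold₃ S * (M ⊗ₖ (1 : Matrix n₁ n₁ R))ᵀ := by
  ext k ⟨j, i⟩
  simp [mul_apply, Fintype.sum_prod_type, one_apply, mul_ite, mul_comm]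

end Cross

/-! ## Commutation (12.4.16), composition (12.4.17), identity -/

section Algebra

variable [CommSemiring R]

/-- GVL (12.4.16): `(𝓢 ×₁ F) ×₂ G = (𝓢 ×₂ G) ×₁ F`.
[cite: GolubVanLoan2013, §12.4.10 (12.4.16)] [cite: KoldaBader2009, §2.5] -/
theorem modeProd₁_modeProd₂_comm [Fintype n₁] [Fintype n₂] (S : n₁ → n₂ → n₃ → R)
    (F : Matrix m₁ n₁ R) (G : Matrix m₂ n₂ R) :
    modeProd₂ (modeProd₁ S F) G = modeProd₁ (modeProd₂ S G) F := by
  funext i j k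
  simp only [modeProd₁_apply, modeProd₂_apply, Finset.mul_sum]
  rw [Finset.sum_comm]
  exact Finset.sum_congr rfl fun _ _ => Finset.sum_congr rfl fun _ _ => by ring

/-- GVL (12.4.16): `(𝓢 ×₁ F) ×₃ G = (𝓢 ×₃ G) ×₁ F`.
[cite: GolubVanLoan2013, §12.4.10 (12.4.16)] [cite: KoldaBader2009, §2.5] -/
theorem modeProd₁_modeProd₃_comm [Fintype n₁] [Fintype n₃] (S : n₁ → n₂ → n₃ → R)
    (F : Matrix m₁ n₁ R) (G : Matrix m₃ n₃ R) :
    modeProd₃ (modeProd₁ S F) G = modeProd₁ (modeProd₃ S G) F := by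
  funext i j k
  simp only [modeProd₁_apply, modeProd₃_apply, Finset.mul_sum]
  rw [Finset.sum_comm]
  exact Finset.sum_congr rfl fun _ _ => Finset.sum_congr rfl fun _ _ => by ring

/-- GVL (12.4.16): `(𝓢 ×₂ F) ×₃ G = (𝓢 ×₃ G) ×₂ F`.
[cite: GolubVanLoan2013, §12.4.10 (12.4.16)] [cite: KoldaBader2009, §2.5] -/
theorem modeProd₂_modeProd₃_comm [Fintype n₂] [Fintype n₃] (S : n₁ → n₂ → n₃ → R)
    (F : Matrix m₂ n₂ R) (G : Matrix m₃ n₃ R) :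
    modeProd₃ (modeProd₂ S F) G = modeProd₂ (modeProd₃ S G) F := by
  funext i j k
  simp only [modeProd₂_apply, modeProd₃_apply, Finset.mul_sum]
  rw [Finset.sum_comm]
  exact Finset.sum_congr rfl fun _ _ => Finset.sum_congr rfl fun _ _ => by ring

/-- GVL (12.4.17) / Kolda–Bader `𝓧 ×ₙ A ×ₙ B = 𝓧 ×ₙ (BA)`, mode 1: `(𝓢 ×₁ F) ×₁ G = 𝓢 ×₁ (G F)`.
[cite: GolubVanLoan2013, §12.4.10 (12.4.17)] [cite: KoldaBader2009, §2.5] -/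
theorem modeProd₁_modeProd₁ [Fintype n₁] [Fintype m₁] (S : n₁ → n₂ → n₃ → R)
    (F : Matrix m₁ n₁ R) (G : Matrix l₁ m₁ R) :
    modeProd₁ (modeProd₁ S F) G = modeProd₁ S (G * F) := by
  apply unfold₁_injective
  rw [unfold₁_modeProd₁, unfold₁_modeProd₁, unfold₁_modeProd₁, Matrix.mul_assoc]

/-- (12.4.17), mode 2: `(𝓢 ×₂ F) ×₂ G = 𝓢 ×₂ (G F)`.
[cite: GolubVanLoan2013, §12.4.10 (12.4.17)] [cite: KoldaBader2009, §2.5] -/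
theorem modeProd₂_modeProd₂ [Fintype n₂] [Fintype m₂] (S : n₁ → n₂ → n₃ → R)
    (F : Matrix m₂ n₂ R) (G : Matrix l₂ m₂ R) :
    modeProd₂ (modeProd₂ S F) G = modeProd₂ S (G * F) := by
  funext i j k
  simp only [modeProd₂_apply, Finset.mul_sum, mul_apply, Finset.sum_mul]
  rw [Finset.sum_comm]
  exact Finset.sum_congr rfl fun _ _ => Finset.sum_congr rfl fun _ _ => by ring

/-- (12.4.17), mode 3: `(𝓢 ×₃ F) ×₃ G = 𝓢 ×₃ (G F)`.
[cite: GolubVanLoan2013, §12.4.10 (12.4.17)] [cite: KoldaBader2009, §2.5] -/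
theorem modeProd₃_modeProd₃ [Fintype n₃] [Fintype m₃] (S : n₁ → n₂ → n₃ → R)
    (F : Matrix m₃ n₃ R) (G : Matrix l₃ m₃ R) :
    modeProd₃ (modeProd₃ S F) G = modeProd₃ S (G * F) := by
  funext i j k
  simp only [modeProd₃_apply, Finset.mul_sum, mul_apply, Finset.sum_mul]
  rw [Finset.sum_comm]
  exact Finset.sum_congr rfl fun _ _ => Finset.sum_congr rfl fun _ _ => by ring

/-- `𝓢 ×₁ I = 𝓢`.  [cite: GolubVanLoan2013, §12.4.10 (12.4.14)] -/
@[simp]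
theorem modeProd₁_one [Fintype n₁] [DecidableEq n₁] (S : n₁ → n₂ → n₃ → R) :
    modeProd₁ S (1 : Matrix n₁ n₁ R) = S := by
  funext i j k
  simp [one_apply, ite_mul]

/-- `𝓢 ×₂ I = 𝓢`.  [cite: GolubVanLoan2013, §12.4.10 (12.4.14)] -/
@[simp]
theorem modeProd₂_one [Fintype n₂] [DecidableEq n₂] (S : n₁ → n₂ → n₃ → R) :
    modeProd₂ S (1 : Matrix n₂ n₂ R) = S := by
  funext i j k
  simp [one_apply, ite_mul]

/-- `𝓢 ×₃ I = 𝓢`.  [cite: GolubVanLoan2013, §12.4.10 (12.4.14)] -/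
@[simp]
theorem modeProd₃_one [Fintype n₃] [DecidableEq n₃] (S : n₁ → n₂ → n₃ → R) :
    modeProd₃ S (1 : Matrix n₃ n₃ R) = S := by
  funext i j k
  simp [one_apply, ite_mul]

end Algebra

/-! ## Theorem 12.4.1 (order 3): unfoldings of the multilinear product -/

section Multilinear

variable [CommSemiring R] [Fintype n₁] [Fintype n₂] [Fintype n₃]

/-- GVL (12.4.18), `d = 3`: the multilinear product entrywise,
`(𝓢 ×₁ M₁ ×₂ M₂ ×₃ M₃)(i, j, k) = Σ_{i', j', k'} M₁ i i' · M₂ j j' · M₃ k k' · 𝓢 i' j' k'`.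
[cite: GolubVanLoan2013, §12.4.11 (12.4.18)] [cite: KoldaBader2009, §4 (4.1) elementwise] -/
theorem multilinear₃_apply (S : n₁ → n₂ → n₃ → R) (M₁ : Matrix m₁ n₁ R) (M₂ : Matrix m₂ n₂ R)
    (M₃ : Matrix m₃ n₃ R) (i : m₁) (j : m₂) (k : m₃) :
    modeProd₃ (modeProd₂ (modeProd₁ S M₁) M₂) M₃ i j k =
      ∑ i', ∑ j', ∑ k', M₁ i i' * M₂ j j' * M₃ k k' * S i' j' k' := by
  -- `Σ_{k'} M₃ k k' · Σ_{j'} M₂ j j' · Σ_{i'} M₁ i i' · S i' j' k'`, reordered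
  have h : ∀ k', M₃ k k' * ∑ j', M₂ j j' * ∑ i', M₁ i i' * S i' j' k' =
      ∑ i', ∑ j', M₁ i i' * M₂ j j' * M₃ k k' * S i' j' k' := by
    intro k'
    rw [Finset.mul_sum, Finset.sum_comm]
    refine Finset.sum_congr rfl fun i' _ => ?_
    rw [Finset.mul_sum, Finset.mul_sum]
    refine Finset.sum_congr rfl fun j' _ => by ring
  simp only [modeProd₁_apply, modeProd₂_apply, modeProd₃_apply, h]
  rw [Finset.sum_comm]
  refine Finset.sum_congr rfl fun i' _ => ?_
  rw [Finset.sum_comm]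

/-- **GVL Theorem 12.4.1** (`d = 3`, mode 1): `(𝓢 ×₁ M₁ ×₂ M₂ ×₃ M₃)₍₁₎ = M₁ · 𝓢₍₁₎ · (M₃ ⊗ M₂)ᵀ`.
[cite: GolubVanLoan2013, Thm. 12.4.1] [cite: KoldaBader2009, §4 (matricized Tucker, p. 21)] -/
theorem unfold₁_multilinear₃ [Fintype m₂] [DecidableEq n₃] [DecidableEq m₂] (S : n₁ → n₂ → n₃ → R)
    (M₁ : Matrix m₁ n₁ R) (M₂ : Matrix m₂ n₂ R) (M₃ : Matrix m₃ n₃ R) :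
    unfold₁ (modeProd₃ (modeProd₂ (modeProd₁ S M₁) M₂) M₃) =
      M₁ * unfold₁ S * (M₃ ⊗ₖ M₂)ᵀ := by
  rw [unfold₁_modeProd₃, unfold₁_modeProd₂, unfold₁_modeProd₁, Matrix.mul_assoc,
    Matrix.mul_assoc, ← transpose_mul, ← mul_kronecker_mul, Matrix.mul_one, Matrix.one_mul,
    ← Matrix.mul_assoc]

/-- **GVL Theorem 12.4.1** (`d = 3`, mode 2): `(𝓢 ×₁ M₁ ×₂ M₂ ×₃ M₃)₍₂₎ = M₂ · 𝓢₍₂₎ · (M₃ ⊗ M₁)ᵀ`.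
[cite: GolubVanLoan2013, Thm. 12.4.1] [cite: KoldaBader2009, §4 (matricized Tucker, p. 21)] -/
theorem unfold₂_multilinear₃ [Fintype m₁] [DecidableEq n₃] [DecidableEq m₁] (S : n₁ → n₂ → n₃ → R)
    (M₁ : Matrix m₁ n₁ R) (M₂ : Matrix m₂ n₂ R) (M₃ : Matrix m₃ n₃ R) :
    unfold₂ (modeProd₃ (modeProd₂ (modeProd₁ S M₁) M₂) M₃) =
      M₂ * unfold₂ S * (M₃ ⊗ₖ M₁)ᵀ := by
  rw [unfold₂_modeProd₃, unfold₂_modeProd₂, unfold₂_modeProd₁, Matrix.mul_assoc,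
    Matrix.mul_assoc, ← transpose_mul, ← mul_kronecker_mul, Matrix.mul_one, Matrix.one_mul,
    Matrix.mul_assoc]

/-- **GVL Theorem 12.4.1** (`d = 3`, mode 3): `(𝓢 ×₁ M₁ ×₂ M₂ ×₃ M₃)₍₃₎ = M₃ · 𝓢₍₃₎ · (M₂ ⊗ M₁)ᵀ`.
[cite: GolubVanLoan2013, Thm. 12.4.1] [cite: KoldaBader2009, §4 (matricized Tucker, p. 21)] -/
theorem unfold₃_multilinear₃ [Fintype m₁] [DecidableEq n₂] [DecidableEq m₁] (S : n₁ → n₂ → n₃ → R)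
    (M₁ : Matrix m₁ n₁ R) (M₂ : Matrix m₂ n₂ R) (M₃ : Matrix m₃ n₃ R) :
    unfold₃ (modeProd₃ (modeProd₂ (modeProd₁ S M₁) M₂) M₃) =
      M₃ * unfold₃ S * (M₂ ⊗ₖ M₁)ᵀ := by
  rw [unfold₃_modeProd₃, unfold₃_modeProd₂, unfold₃_modeProd₁, Matrix.mul_assoc,
    ← transpose_mul, ← mul_kronecker_mul, Matrix.mul_one, Matrix.one_mul, Matrix.mul_assoc]

end Multilinear

section Inverse

variable {K : Type u} [Field K] [Fintype n₁] [Fintype n₂] [Fintype n₃] [DecidableEq n₁]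
  [DecidableEq n₂] [DecidableEq n₃]

/-- **GVL Theorem 12.4.1**, second part (`d = 3`): if `M₁, M₂, M₃` are nonsingular and
`𝓐 = 𝓢 ×₁ M₁ ×₂ M₂ ×₃ M₃`, then `𝓢 = 𝓐 ×₁ M₁⁻¹ ×₂ M₂⁻¹ ×₃ M₃⁻¹`.
[cite: GolubVanLoan2013, Thm. 12.4.1] -/
theorem multilinear₃_inv (S : n₁ → n₂ → n₃ → K) {M₁ : Matrix n₁ n₁ K} {M₂ : Matrix n₂ n₂ K}
    {M₃ : Matrix n₃ n₃ K} (h₁ : IsUnit M₁.det) (h₂ : IsUnit M₂.det) (h₃ : IsUnit M₃.det) :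
    modeProd₃ (modeProd₂ (modeProd₁
      (modeProd₃ (modeProd₂ (modeProd₁ S M₁) M₂) M₃) M₁⁻¹) M₂⁻¹) M₃⁻¹ = S := by
  rw [← modeProd₁_modeProd₃_comm, ← modeProd₁_modeProd₂_comm, modeProd₁_modeProd₁,
    Matrix.nonsing_inv_mul _ h₁, modeProd₁_one, ← modeProd₂_modeProd₃_comm, modeProd₂_modeProd₂,
    Matrix.nonsing_inv_mul _ h₂, modeProd₂_one, modeProd₃_modeProd₃, Matrix.nonsing_inv_mul _ h₃,
    modeProd₃_one]

end Inverse

/-! ## CP (Kruskal) tensors: unfoldings (Kolda–Bader (3.2), GVL §12.5.4) and the diagonal core -/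

section CP

variable [CommSemiring R] {r : Type*}

/-- The (super)diagonal order-3 core tensor `diag₃(λ)`, `(a, b, c) ↦ λ_a` if `a = b = c`, else `0`.
[cite: KoldaBader2009, §2.3 (diagonal tensors)] -/
def superdiag₃ [DecidableEq r] (lam : r → R) : r → r → r → R :=
  fun a b c => if a = b ∧ b = c then lam a else 0

/-- [cite: KoldaBader2009, §2.3] -/
@[simp]
theorem superdiag₃_apply [DecidableEq r] (lam : r → R) (a b c : r) :
    superdiag₃ lam a b c = if a = b ∧ b = c then lam a else 0 := rfl

variable [Fintype r]

/-- The CP / Kruskal tensor `⟦λ; A, B, C⟧ = Σ_s λ_s · a_s ∘ b_s ∘ c_s`,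
`(i, j, k) ↦ Σ_s λ_s · A i s · B j s · C k s`.
[cite: KoldaBader2009, §3 (3.1)-(3.3)] [cite: GolubVanLoan2013, §12.5.4] -/
def cp₃ (lam : r → R) (A : Matrix n₁ r R) (B : Matrix n₂ r R) (C : Matrix n₃ r R) :
    n₁ → n₂ → n₃ → R :=
  fun i j k => ∑ s, lam s * (A i s * B j s * C k s)

/-- [cite: KoldaBader2009, §3 (3.1)] -/
@[simp]
theorem cp₃_apply (lam : r → R) (A : Matrix n₁ r R) (B : Matrix n₂ r R) (C : Matrix n₃ r R)
    (i : n₁) (j : n₂) (k : n₃) : cp₃ lam A B C i j k = ∑ s, lam s * (A i s * B j s * C k s) :=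
  rfl

/-- A CP tensor is the `λ`-weighted sum of the rank-1 tensors built from the factor columns.
[cite: KoldaBader2009, §3 (3.3)] -/
theorem cp₃_eq_sum_outer₃ (lam : r → R) (A : Matrix n₁ r R) (B : Matrix n₂ r R)
    (C : Matrix n₃ r R) :
    cp₃ lam A B C = ∑ s, lam s • outer₃ (fun i => A i s) (fun j => B j s) fun k => C k s := by
  funext i j k
  simp [Finset.sum_apply, outer₃]

/-- Kolda–Bader (3.2) / GVL §12.5.4, mode 1: `X₍₁₎ = A · diag(λ) · (C ⊙ B)ᵀ`, the Khatri–Rao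
factor written entrywise, `(C ⊙ B) (k, j) s = C k s * B j s` (pair indexing as for `⊗ₖ`).
[cite: KoldaBader2009, §3 (3.2)] [cite: GolubVanLoan2013, §12.5.4] -/
theorem unfold₁_cp₃ [DecidableEq r] (lam : r → R) (A : Matrix n₁ r R) (B : Matrix n₂ r R)
    (C : Matrix n₃ r R) :
    unfold₁ (cp₃ lam A B C) =
      A * diagonal lam * (Matrix.of fun (kj : n₃ × n₂) s => C kj.1 s * B kj.2 s)ᵀ := by
  ext i ⟨k, j⟩
  rw [mul_apply]
  simp only [unfold₁_apply, cp₃_apply, Matrix.mul_diagonal, transpose_apply, of_apply]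
  exact Finset.sum_congr rfl fun _ _ => by ring

/-- Kolda–Bader (3.2), mode 2: `X₍₂₎ = B · diag(λ) · (C ⊙ A)ᵀ`.
[cite: KoldaBader2009, §3 (3.2)] [cite: GolubVanLoan2013, §12.5.4] -/
theorem unfold₂_cp₃ [DecidableEq r] (lam : r → R) (A : Matrix n₁ r R) (B : Matrix n₂ r R)
    (C : Matrix n₃ r R) :
    unfold₂ (cp₃ lam A B C) =
      B * diagonal lam * (Matrix.of fun (ki : n₃ × n₁) s => C ki.1 s * A ki.2 s)ᵀ := by
  ext j ⟨k, i⟩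
  rw [mul_apply]
  simp only [unfold₂_apply, cp₃_apply, Matrix.mul_diagonal, transpose_apply, of_apply]
  exact Finset.sum_congr rfl fun _ _ => by ring

/-- Kolda–Bader (3.2), mode 3: `X₍₃₎ = C · diag(λ) · (B ⊙ A)ᵀ`.
[cite: KoldaBader2009, §3 (3.2)] [cite: GolubVanLoan2013, §12.5.4] -/
theorem unfold₃_cp₃ [DecidableEq r] (lam : r → R) (A : Matrix n₁ r R) (B : Matrix n₂ r R)
    (C : Matrix n₃ r R) :
    unfold₃ (cp₃ lam A B C) =
      C * diagonal lam * (Matrix.of fun (ji : n₂ × n₁) s => B ji.1 s * A ji.2 s)ᵀ := by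
  ext k ⟨j, i⟩
  rw [mul_apply]
  simp only [unfold₃_apply, cp₃_apply, Matrix.mul_diagonal, transpose_apply, of_apply]
  exact Finset.sum_congr rfl fun _ _ => by ring

/-- CP is the multilinear (Tucker) product with a superdiagonal core:
`⟦λ; A, B, C⟧ = diag₃(λ) ×₁ A ×₂ B ×₃ C`.
[cite: KoldaBader2009, §4 (CP = Tucker with superdiagonal core, p. 21)] -/
theorem multilinear₃_superdiag₃ [DecidableEq r] (lam : r → R) (A : Matrix n₁ r R)
    (B : Matrix n₂ r R) (C : Matrix n₃ r R) :
    modeProd₃ (modeProd₂ (modeProd₁ (superdiag₃ lam) A) B) C = cp₃ lam A B C := by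
  funext i j k
  rw [multilinear₃_apply, cp₃_apply]
  refine Finset.sum_congr rfl fun s _ => ?_
  rw [Finset.sum_eq_single s, Finset.sum_eq_single s]
  · simp only [superdiag₃_apply, and_self, if_true]; ring
  all_goals first | (intro b _ hb; simp [superdiag₃_apply, hb.symm]) | simp

end CP

end Literature.LinearAlgebra.TensorNetworks
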